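/- Width seat `ym-line-sfw-p2-w5` (prover-ym-line-sfw-p2-w5-g19-0), free hands on planner ym-idea-2 g17's STUB-PLAN-U2 rev 2 §3 (3) for LINE-20
«landau-rung3» stub U2 `stub_landauRepresentativeStrong : LandauRepresentativeBound` on ⟨stmt-QuantumFields-24336⟩: the bootstrap re-run with the
sharp Stage I. -/
import Summits.QuantumFields.YangMills.Theorems.AllWindowsColdBoxBoxHighLineBootstrapAssembly
import Summits.QuantumFields.YangMills.Theorems.AllWindowsColdBoxBoxHighLineUniformTemporalGauge

/-!
# LINE-20 U2: the one-step bootstrap re-run with the sharp Stage I — `LandauKernelDecay → LandauRepresentativeBound`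

STUB-PLAN-U2 rev 2 §3 (planner ym-idea-2 g17): w5 g18's one-step bootstrap ✓`landauBootstrapBound_of_landauKernelDecay` reads
`m ≤ C_K·H·L·s + C₁·C_b·L·√(192·D)·m` with `D` the TOTAL cold-box defect of the Landau minimiser; with the forest Stage I `D ≤ 72900·H⁸·s²` this needed
the v10 premise `s·H⁴·L² ≤ c₀`.  With the SHARP Stage I ✓`UniformGauge.sharpStageI` (T-U2.S: `D ≤ C_S·H⁶·s²` under `s·H² ≤ c_S`, through the minimiser's
`hmin`) the SAME assembly closes under EXACTLY the premise `s·H³·(1+log H) ≤ c₀` of the v9 statement of record `LandauRepresentativeBound` and yields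
EXACTLY its conclusion `linkDefect ≤ C·H²(1+log H)²·s²`:

* `exists_landau_total_sharp` — Stage I, sharp total form: interior `g`, `U^g` in lattice Landau gauge, `Σ_{e∈box} linkDefect (U^g) e ≤ C_S·H⁶·s²`;
* `summed_error_le_of_total` — the summed BCH error `Σ_p |G_p|·n_p ≤ (192·C₂'·C_S + 1)·L·H³·s` from ANY total bound `D ≤ C_S·H⁶·s²`
  (Cauchy–Schwarz ✓`sq_sum_abs_mul_linkSum_le`, ℓ²-row ✓`gradKernelL2`);
* **`landauRepresentativeBound_of_landauKernelDecay : LandauKernelDecay → LandauRepresentativeBound`** — so the registered stub U2 follows from S3b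
  (`LandauKernelDecay`, the second conjunct of LINE-19's S3 / LINE-20's U1 package) ALONE; by-name closer once S3b lands:
  `theorem stub_landauRepresentativeStrong : LandauRepresentativeBound := landauRepresentativeBound_of_landauKernelDecay ‹S3b›`;
* `landauBootstrapBound_of_landauRepresentativeBound` — the v9 statement implies LINE-19's v11 S4b `LandauBootstrapBound` (monotonicity of premise
  and conclusion in `H ≥ 1`, `L ≥ 1`), for the record.

Everything proved; no definition; standard axioms.  HONEST LABEL: a CONDITIONAL reduction between registered stubs of critic-PASSed DRAFT-by-design lines
on the R2ξ″ RECORD-rung cruxes 24336 / 24004 — S3b `LandauKernelDecay` is OPEN, so U2 is NOT closed by this file; no crux, rung or summit is proved; the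
Yang–Mills mass gap is NOT proved by this file.
-/

set_option autoImplicit false

noncomputable section

open Finset Matrix
open Literature.MathematicalPhysics.QuantumFieldTheory hiding boxEdges
open Literature.MathematicalPhysics.QuantumFieldTheory.LatticeMaxwell
open Literature.MathematicalPhysics.QuantumFieldTheory.AxialGauge
open Summit.QuantumFields.YangMills.Theorems.WeakCouplingRates
open Literature.Probability.LatticeModels (Site)
open Literature.MathematicalPhysics.QuantumLattice (LGConfig gaugeTransformZd plaquetteHolonomyZd fundamentalRep)

namespace Summit.QuantumFields.YangMills.Theorems.AllWindowsColdBoxBoxHighLine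

/-! ## Stage I, sharp total form -/

/-- **Stage I, sharp total form**: if some interior gauge transform has total cold-box defect `≤ D`, then the Landau MINIMISER is an interior gauge
transform putting `U` in lattice Landau gauge with total defect `≤ D` and every single link defect `≤ D`. -/
theorem exists_landau_total_of_witness {H : ℕ} {U : LGConfig 4 SU2} {D : ℝ} {g' : Site 4 → SU2} (hg' : IsInteriorGauge H g')
    (hD : ∑ e ∈ boxEdges 4 (2 * H + 1), linkDefect (gaugeTransformZd g' U) e ≤ D) :
    ∃ g : Site 4 → SU2, IsInteriorGauge H g ∧ InLandauGauge H (gaugeTransformZd g U) ∧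
      (∑ e ∈ boxEdges 4 (2 * H + 1), linkDefect (gaugeTransformZd g U) e ≤ D) ∧
      ∀ e ∈ boxEdges 4 (2 * H + 1), linkDefect (gaugeTransformZd g U) e ≤ D := by
  obtain ⟨g, hg, hL, hmin⟩ := exists_interior_landauGauge_min H U
  have htot : ∑ e ∈ boxEdges 4 (2 * H + 1), linkDefect (gaugeTransformZd g U) e ≤ D := (hmin _ hg').trans hD
  refine ⟨g, hg, hL, htot, fun e he => ?_⟩
  exact (Finset.single_le_sum (f := fun e => linkDefect (gaugeTransformZd g U) e) (fun e _ => linkDefect_nonneg _ e) he).trans htot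

/-! ## The summed BCH error from a total defect bound `D ≤ C_S·H⁶·s²` -/

/-- **The summed BCH error is `≤ (192·C₂'·C_S + 1)·(1+log H)·H³·s`** whenever the total defect is `≤ C_S·H⁶·s²` (Cauchy–Schwarz
✓`sq_sum_abs_mul_linkSum_le`, the ℓ²-row bound). -/
theorem summed_error_le_of_total {H : ℕ} {U : LGConfig 4 SU2} (hU : ColdWall H U) {g : Site 4 → SU2} (hg : IsInteriorGauge H g)
    {s CS : ℝ} (hs : 0 ≤ s) (hCS : 0 ≤ CS)
    (htot : ∑ e ∈ boxEdges 4 (2 * H + 1), linkDefect (gaugeTransformZd g U) e ≤ CS * (H : ℝ) ^ 6 * s ^ 2)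
    (e₀ : LandauFree H) {C2' : ℝ} (hC2'0 : 0 ≤ C2')
    (hK2' : ∑ p ∈ hodgePlaqs H, (((hodgeQ H)⁻¹ *ᵥ landauCoeff H p) e₀) ^ 2 ≤ C2' * (1 + Real.log H) ^ 2) :
    ∑ p ∈ hodgePlaqs H, |((hodgeQ H)⁻¹ *ᵥ landauCoeff H p) e₀| * ∑ k : Fin 4, ∑ c' : Fin 3,
        |imVec ((![gaugeTransformZd g U (p.1, p.2.1), gaugeTransformZd g U (p.1 + Pi.single p.2.1 1, p.2.2),
          gaugeTransformZd g U (p.1 + Pi.single p.2.2 1, p.2.1), gaugeTransformZd g U (p.1, p.2.2)] : Fin 4 → SU2) k) c'| ≤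
      (192 * C2' * CS + 1) * (1 + Real.log H) * (H : ℝ) ^ 3 * s := by
  have hsq := sq_sum_abs_mul_linkSum_le hU hg (fun p => ((hodgeQ H)⁻¹ *ᵥ landauCoeff H p) e₀)
  have hL0 : 0 ≤ 1 + Real.log (H : ℝ) := by have := Real.log_natCast_nonneg H; linarith
  have hH0 : 0 ≤ (H : ℝ) := Nat.cast_nonneg H
  have hB0 : 0 ≤ (192 * C2' * CS + 1) * (1 + Real.log H) * (H : ℝ) ^ 3 * s := by positivity
  have htot0 : 0 ≤ ∑ e ∈ boxEdges 4 (2 * H + 1), linkDefect (gaugeTransformZd g U) e :=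
    Finset.sum_nonneg fun e _ => linkDefect_nonneg _ e
  have hprod : (∑ p ∈ hodgePlaqs H, (((hodgeQ H)⁻¹ *ᵥ landauCoeff H p) e₀) ^ 2) *
      (192 * ∑ e ∈ boxEdges 4 (2 * H + 1), linkDefect (gaugeTransformZd g U) e) ≤
      ((192 * C2' * CS + 1) * (1 + Real.log H) * (H : ℝ) ^ 3 * s) ^ 2 := by
    calc (∑ p ∈ hodgePlaqs H, (((hodgeQ H)⁻¹ *ᵥ landauCoeff H p) e₀) ^ 2) *
          (192 * ∑ e ∈ boxEdges 4 (2 * H + 1), linkDefect (gaugeTransformZd g U) e)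
        ≤ (C2' * (1 + Real.log H) ^ 2) * (192 * (CS * (H : ℝ) ^ 6 * s ^ 2)) :=
          mul_le_mul hK2' (mul_le_mul_of_nonneg_left htot (by norm_num)) (by positivity) (by positivity)
      _ = (192 * C2' * CS) * ((1 + Real.log H) * (H : ℝ) ^ 3 * s) ^ 2 := by ring
      _ ≤ ((192 * C2' * CS + 1) * (1 + Real.log H) * (H : ℝ) ^ 3 * s) ^ 2 := by
          have hX : 0 ≤ 192 * C2' * CS := by positivity
          have hY : 0 ≤ ((1 + Real.log (H : ℝ)) * (H : ℝ) ^ 3 * s) ^ 2 := sq_nonneg _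
          nlinarith
  have hS0 : 0 ≤ ∑ p ∈ hodgePlaqs H, |((hodgeQ H)⁻¹ *ᵥ landauCoeff H p) e₀| * ∑ k : Fin 4, ∑ c' : Fin 3,
        |imVec ((![gaugeTransformZd g U (p.1, p.2.1), gaugeTransformZd g U (p.1 + Pi.single p.2.1 1, p.2.2),
          gaugeTransformZd g U (p.1 + Pi.single p.2.2 1, p.2.1), gaugeTransformZd g U (p.1, p.2.2)] : Fin 4 → SU2) k) c'| :=
    Finset.sum_nonneg fun p _ => mul_nonneg (abs_nonneg _)
      (Finset.sum_nonneg fun _ _ => Finset.sum_nonneg fun _ _ => abs_nonneg _)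
  exact (pow_le_pow_iff_left₀ hS0 hB0 (by norm_num : (2 : ℕ) ≠ 0)).1 (hsq.trans hprod)

/-! ## The bootstrap with the sharp Stage I -/

/-- Real arithmetic of the final step (sharp form): `defect ≤ 6m²`, `m ≤ 2·C_K·H·L·s` give `defect ≤ (24C_K²+1)·H²·L²·s²`. -/
theorem bootstrap_defect_bound_sharp {D m CK Hr L s : ℝ} (hD : D ≤ 6 * m ^ 2) (hm0 : 0 ≤ m) (hm : m ≤ 2 * (CK * Hr * L * s)) :
    D ≤ (24 * CK ^ 2 + 1) * Hr ^ 2 * L ^ 2 * s ^ 2 := by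
  have hmsq : m ^ 2 ≤ (2 * (CK * Hr * L * s)) ^ 2 := pow_le_pow_left₀ hm0 hm 2
  have hY : 0 ≤ Hr ^ 2 * L ^ 2 * s ^ 2 := by positivity
  nlinarith

/-- **The one-step bootstrap with the sharp Stage I (STUB-PLAN-U2 rev 2 §3): S3b ⇒ U2**, i.e.
`LandauKernelDecay → LandauRepresentativeBound` (premise `s·H³·(1+log H) ≤ c₀`, conclusion `C·H²(1+log H)²·s²`). -/
theorem landauRepresentativeBound_of_landauKernelDecay (hDec : LandauKernelDecay) : LandauRepresentativeBound := by
  obtain ⟨C₁, hC₁⟩ : QuaternionBCH := quaternionBCH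
  obtain ⟨CK, hK⟩ := h4b1one_of_S3 hDec landauVarianceBounded
  obtain ⟨C2, hK2⟩ := gradKernelL2
  obtain ⟨CS, cS, hCS, hcS, hStage⟩ := UniformGauge.sharpStageI
  obtain ⟨C₁', hC₁'0, hC₁'⟩ : ∃ C : ℝ, 0 ≤ C ∧ C₁ ≤ C := ⟨max C₁ 0, le_max_right _ _, le_max_left _ _⟩
  obtain ⟨CK', hCK'0, hCK'⟩ : ∃ C : ℝ, 0 ≤ C ∧ CK ≤ C := ⟨max CK 0, le_max_right _ _, le_max_left _ _⟩
  obtain ⟨C2', hC2'0, hC2'⟩ : ∃ C : ℝ, 0 ≤ C ∧ C2 ≤ C := ⟨max C2 0, le_max_right _ _, le_max_left _ _⟩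
  obtain ⟨Cb, hCb⟩ : ∃ C : ℝ, C = 192 * C2' * CS + 1 := ⟨_, rfl⟩
  have hCb0 : 0 < Cb := by rw [hCb]; positivity
  obtain ⟨c₀, hc₀⟩ : ∃ c : ℝ, c = min (min cS (1 / (CS + 1))) (1 / (2 * C₁' * Cb + 2)) := ⟨_, rfl⟩
  have hc₀pos : 0 < c₀ := by rw [hc₀]; exact lt_min (lt_min hcS (by positivity)) (by positivity)
  have hc₀S : c₀ ≤ cS := by rw [hc₀]; exact (min_le_left _ _).trans (min_le_left _ _)
  have hc₀1 : c₀ ≤ 1 / (CS + 1) := by rw [hc₀]; exact (min_le_left _ _).trans (min_le_right _ _)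
  have hc₀b : c₀ ≤ 1 / (2 * C₁' * Cb + 2) := by rw [hc₀]; exact min_le_right _ _
  refine ⟨24 * CK' ^ 2 + 1, c₀, by positivity, hc₀pos, ?_⟩
  intro H hH s hs hprem U hU hS
  have hH1 : (1 : ℝ) ≤ H := by exact_mod_cast hH
  have hH0 : (0 : ℝ) ≤ H := by linarith
  have hL1 : 1 ≤ 1 + Real.log (H : ℝ) := by have := Real.log_nonneg hH1; linarith
  have hL0 : 0 ≤ 1 + Real.log (H : ℝ) := by linarith
  -- the premise `s·H³·L ≤ c₀` gives `s·H² ≤ c_S` and `s·H³ ≤ c₀`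
  have hsH3 : s * (H : ℝ) ^ 3 ≤ c₀ := by
    have h1 : s * (H : ℝ) ^ 3 ≤ s * (H : ℝ) ^ 3 * (1 + Real.log H) := by
      have h0 : 0 ≤ s * (H : ℝ) ^ 3 := by positivity
      nlinarith
    exact h1.trans hprem
  have hsH2 : s * (H : ℝ) ^ 2 ≤ cS := by
    have h1 : s * (H : ℝ) ^ 2 ≤ s * (H : ℝ) ^ 3 := by
      have : (H : ℝ) ^ 2 ≤ (H : ℝ) ^ 3 := pow_le_pow_right₀ hH1 (by norm_num)
      exact mul_le_mul_of_nonneg_left this hs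
    linarith
  -- Stage I, sharp, with the total defect, in the hemisphere
  obtain ⟨g', hg', hD'⟩ := hStage H hH s hs hsH2 U hU hS
  obtain ⟨g, hg, hLandau, htot, hdef⟩ := exists_landau_total_of_witness hg' hD'
  refine ⟨g, hg, hLandau, ?_⟩
  have h1 : CS * (H : ℝ) ^ 6 * s ^ 2 ≤ 1 := by
    -- `CS·(sH³)² ≤ CS·c₀² ≤ CS·c₀ ≤ CS/(CS+1) ≤ 1`
    have hsq : (s * (H : ℝ) ^ 3) ^ 2 ≤ c₀ ^ 2 := pow_le_pow_left₀ (by positivity) hsH3 2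
    have hc₀le1 : c₀ ≤ 1 := hc₀1.trans (by rw [div_le_one (by positivity)]; linarith)
    have hc₀sq : c₀ ^ 2 ≤ c₀ := by nlinarith
    have hCS1 : CS * c₀ ≤ 1 := by
      calc CS * c₀ ≤ CS * (1 / (CS + 1)) := mul_le_mul_of_nonneg_left hc₀1 hCS.le
        _ = CS / (CS + 1) := by ring
        _ ≤ 1 := by rw [div_le_one (by positivity)]; linarith
    calc CS * (H : ℝ) ^ 6 * s ^ 2 = CS * (s * (H : ℝ) ^ 3) ^ 2 := by ring
      _ ≤ CS * c₀ ^ 2 := mul_le_mul_of_nonneg_left hsq hCS.le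
      _ ≤ CS * c₀ := mul_le_mul_of_nonneg_left hc₀sq hCS.le
      _ ≤ 1 := hCS1
  have hre_box : ∀ e ∈ boxEdges 4 (2 * H + 1),
      (1 : ℝ) / 2 ≤ (((gaugeTransformZd g U e : SU2) : Matrix (Fin 2) (Fin 2) ℂ) 0 0).re :=
    fun e he => half_le_re_of_linkDefect_le_one _ e ((hdef e he).trans h1)
  have hre := re_half_le_gaugeTransform hU hg hre_box
  -- the largest su(2)-coordinate over the cold-box links
  have hne : (boxEdges 4 (2 * H + 1) ×ˢ (Finset.univ : Finset (Fin 3))).Nonempty :=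
    ⟨(((fun _ => (0 : ℤ)), (0 : Fin 4)), (0 : Fin 3)), Finset.mem_product.2 ⟨zero_mem_boxEdges hH, Finset.mem_univ _⟩⟩
  obtain ⟨q₀, hq₀, hmax⟩ := Finset.exists_max_image _
    (fun q : Literature.MathematicalPhysics.QuantumLattice.ZdEdge 4 × Fin 3 => |imVec (gaugeTransformZd g U q.1) q.2|) hne
  obtain ⟨m, hm⟩ : ∃ m : ℝ, m = |imVec (gaugeTransformZd g U q₀.1) q₀.2| := ⟨_, rfl⟩
  have hm0 : 0 ≤ m := by rw [hm]; exact abs_nonneg _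
  have hq₀box : q₀.1 ∈ boxEdges 4 (2 * H + 1) := (Finset.mem_product.1 hq₀).1
  have hMbox : ∀ e ∈ boxEdges 4 (2 * H + 1), ∀ c : Fin 3, |imVec (gaugeTransformZd g U e) c| ≤ m := by
    intro e he c
    rw [hm]
    exact hmax (e, c) (Finset.mem_product.2 ⟨he, Finset.mem_univ c⟩)
  have hM := abs_imVec_gaugeTransform_le hU hg hm0 hMbox
  -- the su(2)-coordinate one-form of coordinate `q₀.2` is divergence-free, hence Hodge-represented
  let e₀ : LandauFree H := ⟨⟨q₀.1, mem_boxEdgesAt_of_mem_boxEdges hq₀box⟩, fun h => h hq₀box⟩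
  have hdiv : ∀ x ∈ interiorSites H,
      gradVec H x ⬝ᵥ (fun i : LandauFree H => imVec (gaugeTransformZd g U i.1.1) q₀.2) = 0 :=
    fun x hx => gradVec_dotProduct_imVec_eq_zero_of_inLandauGauge hLandau hx q₀.2
  have hrep := hodgeRepresentation' (fun i : LandauFree H => imVec (gaugeTransformZd g U i.1.1) q₀.2) hdiv e₀
  -- the row sum H4b.1 from S3
  have hrow : ∑ p ∈ hodgePlaqs H, |((hodgeQ H)⁻¹ *ᵥ landauCoeff H p) e₀| ≤ CK' * (H : ℝ) * (1 + Real.log H) :=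
    (hK H hH e₀).trans (mul_le_mul_of_nonneg_right (mul_le_mul_of_nonneg_right hCK' (Nat.cast_nonneg _)) hL0)
  -- the summed error `Σ_p |G_p| n_p ≤ Cb·L·H³·s`
  have hK2' : ∑ p ∈ hodgePlaqs H, (((hodgeQ H)⁻¹ *ᵥ landauCoeff H p) e₀) ^ 2 ≤ C2' * (1 + Real.log H) ^ 2 :=
    (hK2 H hH e₀).trans (mul_le_mul_of_nonneg_right hC2' (by positivity))
  have hErr := summed_error_le_of_total hU hg hs hCS.le htot e₀ hC2'0 hK2'
  rw [← hCb] at hErr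
  -- per-plaquette circulation bound `|Λ_p| ≤ s + C₁'·m·n_p`
  have hΛ : ∀ p ∈ hodgePlaqs H,
      |landauCoeff H p ⬝ᵥ (fun i : LandauFree H => imVec (gaugeTransformZd g U i.1.1) q₀.2)| ≤
        s + C₁' * m * ∑ k : Fin 4, ∑ c' : Fin 3,
        |imVec ((![gaugeTransformZd g U (p.1, p.2.1), gaugeTransformZd g U (p.1 + Pi.single p.2.1 1, p.2.2),
          gaugeTransformZd g U (p.1 + Pi.single p.2.2 1, p.2.1), gaugeTransformZd g U (p.1, p.2.2)] : Fin 4 → SU2) k) c'| := by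
    intro p hp
    have hc := abs_circulation_sub_imVec_holonomy_le hU hg hC₁ hre hM p q₀.2
    have hh := abs_imVec_holonomy_gaugeTransform_le hU hs hS g hp q₀.2
    have hn0 : 0 ≤ ∑ k : Fin 4, ∑ c' : Fin 3,
        |imVec ((![gaugeTransformZd g U (p.1, p.2.1), gaugeTransformZd g U (p.1 + Pi.single p.2.1 1, p.2.2),
          gaugeTransformZd g U (p.1 + Pi.single p.2.2 1, p.2.1), gaugeTransformZd g U (p.1, p.2.2)] : Fin 4 → SU2) k) c'| :=
      Finset.sum_nonneg fun _ _ => Finset.sum_nonneg fun _ _ => abs_nonneg _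
    have hmono : C₁ * m * ∑ k : Fin 4, ∑ c' : Fin 3,
        |imVec ((![gaugeTransformZd g U (p.1, p.2.1), gaugeTransformZd g U (p.1 + Pi.single p.2.1 1, p.2.2),
          gaugeTransformZd g U (p.1 + Pi.single p.2.2 1, p.2.1), gaugeTransformZd g U (p.1, p.2.2)] : Fin 4 → SU2) k) c'| ≤
        C₁' * m * ∑ k : Fin 4, ∑ c' : Fin 3,
        |imVec ((![gaugeTransformZd g U (p.1, p.2.1), gaugeTransformZd g U (p.1 + Pi.single p.2.1 1, p.2.2),
          gaugeTransformZd g U (p.1 + Pi.single p.2.2 1, p.2.1), gaugeTransformZd g U (p.1, p.2.2)] : Fin 4 → SU2) k) c'| :=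
      mul_le_mul_of_nonneg_right (mul_le_mul_of_nonneg_right hC₁' hm0) hn0
    calc |landauCoeff H p ⬝ᵥ (fun i : LandauFree H => imVec (gaugeTransformZd g U i.1.1) q₀.2)|
        = |(landauCoeff H p ⬝ᵥ (fun i : LandauFree H => imVec (gaugeTransformZd g U i.1.1) q₀.2) -
            imVec (plaquetteHolonomyZd (gaugeTransformZd g U) p.1 p.2.1 p.2.2) q₀.2) +
            imVec (plaquetteHolonomyZd (gaugeTransformZd g U) p.1 p.2.1 p.2.2) q₀.2| := by rw [sub_add_cancel]
      _ ≤ |landauCoeff H p ⬝ᵥ (fun i : LandauFree H => imVec (gaugeTransformZd g U i.1.1) q₀.2) -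
            imVec (plaquetteHolonomyZd (gaugeTransformZd g U) p.1 p.2.1 p.2.2) q₀.2| +
            |imVec (plaquetteHolonomyZd (gaugeTransformZd g U) p.1 p.2.1 p.2.2) q₀.2| := abs_add_le _ _
      _ ≤ C₁ * m * (∑ k : Fin 4, ∑ c' : Fin 3,
        |imVec ((![gaugeTransformZd g U (p.1, p.2.1), gaugeTransformZd g U (p.1 + Pi.single p.2.1 1, p.2.2),
          gaugeTransformZd g U (p.1 + Pi.single p.2.2 1, p.2.1), gaugeTransformZd g U (p.1, p.2.2)] : Fin 4 → SU2) k) c'|) + s :=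
          add_le_add hc hh
      _ ≤ C₁' * m * (∑ k : Fin 4, ∑ c' : Fin 3,
        |imVec ((![gaugeTransformZd g U (p.1, p.2.1), gaugeTransformZd g U (p.1 + Pi.single p.2.1 1, p.2.2),
          gaugeTransformZd g U (p.1 + Pi.single p.2.2 1, p.2.1), gaugeTransformZd g U (p.1, p.2.2)] : Fin 4 → SU2) k) c'|) + s := by
          linarith [hmono]
      _ = s + C₁' * m * ∑ k : Fin 4, ∑ c' : Fin 3,
        |imVec ((![gaugeTransformZd g U (p.1, p.2.1), gaugeTransformZd g U (p.1 + Pi.single p.2.1 1, p.2.2),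
          gaugeTransformZd g U (p.1 + Pi.single p.2.2 1, p.2.1), gaugeTransformZd g U (p.1, p.2.2)] : Fin 4 → SU2) k) c'| := by ring
  -- the key estimate `m ≤ CK'·H·L·s + C₁'·Cb·(L·H³·s)·m`
  have hkey : m ≤ CK' * (H : ℝ) * (1 + Real.log H) * s + (C₁' * Cb * ((1 + Real.log H) * (H : ℝ) ^ 3 * s)) * m := by
    have hrep' := hrep
    change imVec (gaugeTransformZd g U q₀.1) q₀.2 = _ at hrep'
    have hmval : m = |∑ p ∈ hodgePlaqs H, ((hodgeQ H)⁻¹ *ᵥ landauCoeff H p) e₀ *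
        (landauCoeff H p ⬝ᵥ fun i : LandauFree H => imVec (gaugeTransformZd g U i.1.1) q₀.2)| := by rw [hm, hrep']
    calc m = |∑ p ∈ hodgePlaqs H, ((hodgeQ H)⁻¹ *ᵥ landauCoeff H p) e₀ *
          (landauCoeff H p ⬝ᵥ fun i : LandauFree H => imVec (gaugeTransformZd g U i.1.1) q₀.2)| := hmval
      _ ≤ ∑ p ∈ hodgePlaqs H, |((hodgeQ H)⁻¹ *ᵥ landauCoeff H p) e₀ *
          (landauCoeff H p ⬝ᵥ fun i : LandauFree H => imVec (gaugeTransformZd g U i.1.1) q₀.2)| := Finset.abs_sum_le_sum_abs _ _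
      _ ≤ ∑ p ∈ hodgePlaqs H, |((hodgeQ H)⁻¹ *ᵥ landauCoeff H p) e₀| *
          (s + C₁' * m * ∑ k : Fin 4, ∑ c' : Fin 3,
        |imVec ((![gaugeTransformZd g U (p.1, p.2.1), gaugeTransformZd g U (p.1 + Pi.single p.2.1 1, p.2.2),
          gaugeTransformZd g U (p.1 + Pi.single p.2.2 1, p.2.1), gaugeTransformZd g U (p.1, p.2.2)] : Fin 4 → SU2) k) c'|) := by
          refine Finset.sum_le_sum fun p hp => ?_
          rw [abs_mul]
          exact mul_le_mul_of_nonneg_left (hΛ p hp) (abs_nonneg _)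
      _ = s * ∑ p ∈ hodgePlaqs H, |((hodgeQ H)⁻¹ *ᵥ landauCoeff H p) e₀| +
          C₁' * m * ∑ p ∈ hodgePlaqs H, |((hodgeQ H)⁻¹ *ᵥ landauCoeff H p) e₀| * ∑ k : Fin 4, ∑ c' : Fin 3,
        |imVec ((![gaugeTransformZd g U (p.1, p.2.1), gaugeTransformZd g U (p.1 + Pi.single p.2.1 1, p.2.2),
          gaugeTransformZd g U (p.1 + Pi.single p.2.2 1, p.2.1), gaugeTransformZd g U (p.1, p.2.2)] : Fin 4 → SU2) k) c'| := by
          rw [Finset.mul_sum, Finset.mul_sum, ← Finset.sum_add_distrib]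
          exact Finset.sum_congr rfl fun p _ => by ring
      _ ≤ s * (CK' * (H : ℝ) * (1 + Real.log H)) + C₁' * m * (Cb * (1 + Real.log H) * (H : ℝ) ^ 3 * s) :=
          add_le_add (mul_le_mul_of_nonneg_left hrow hs) (mul_le_mul_of_nonneg_left hErr (by positivity))
      _ = CK' * (H : ℝ) * (1 + Real.log H) * s + (C₁' * Cb * ((1 + Real.log H) * (H : ℝ) ^ 3 * s)) * m := by ring
  -- smallness of the premise: `C₁'·Cb·(L·H³·s) ≤ C₁'·Cb·c₀ ≤ 1/2`
  have hsmall : C₁' * Cb * ((1 + Real.log H) * (H : ℝ) ^ 3 * s) ≤ 1 / 2 := by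
    have hCC : 0 ≤ C₁' * Cb := mul_nonneg hC₁'0 hCb0.le
    have hpos : (0 : ℝ) < 2 * C₁' * Cb + 2 := by positivity
    have hp1 : (1 + Real.log H) * (H : ℝ) ^ 3 * s ≤ c₀ := by linarith
    calc C₁' * Cb * ((1 + Real.log H) * (H : ℝ) ^ 3 * s) ≤ C₁' * Cb * c₀ := mul_le_mul_of_nonneg_left hp1 hCC
      _ ≤ C₁' * Cb * (1 / (2 * C₁' * Cb + 2)) := mul_le_mul_of_nonneg_left hc₀b hCC
      _ = (C₁' * Cb) / (2 * C₁' * Cb + 2) := by ring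
      _ ≤ 1 / 2 := by rw [div_le_iff₀ hpos]; nlinarith
  -- absorb: `m ≤ A + θ·m`, `θ ≤ 1/2` ⇒ `m ≤ 2A`
  have hm2 : m ≤ 2 * (CK' * (H : ℝ) * (1 + Real.log H) * s) := by nlinarith
  -- the defects
  intro e he
  have hdefect := linkDefect_le_six_mul_sq (gaugeTransformZd g U) e (by linarith [hre_box e he]) (hMbox e he)
  exact bootstrap_defect_bound_sharp hdefect hm0 hm2

/-- For the record: the v9 statement implies LINE-19's v11 S4b statement (`H⁴L² ≥ H³L` in the premise, `L⁴ ≥ L²` in the conclusion). -/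
theorem landauBootstrapBound_of_landauRepresentativeBound (h : LandauRepresentativeBound) : LandauBootstrapBound := by
  obtain ⟨C, c₀, hC, hc₀, hmain⟩ := h
  refine ⟨C, c₀, hC, hc₀, fun H hH s hs hprem U hU hS => ?_⟩
  have hH1 : (1 : ℝ) ≤ H := by exact_mod_cast hH
  have hL1 : 1 ≤ 1 + Real.log (H : ℝ) := by have := Real.log_nonneg hH1; linarith
  have hprem' : s * (H : ℝ) ^ 3 * (1 + Real.log H) ≤ c₀ := by
    have h0 : 0 ≤ s * (H : ℝ) ^ 3 * (1 + Real.log H) := by positivity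
    have h1 : s * (H : ℝ) ^ 3 * (1 + Real.log H) ≤ s * (H : ℝ) ^ 4 * (1 + Real.log H) ^ 2 := by
      have : (H : ℝ) ^ 3 * (1 + Real.log H) ≤ (H : ℝ) ^ 4 * (1 + Real.log H) ^ 2 := by
        have hH3 : (H : ℝ) ^ 3 ≤ (H : ℝ) ^ 4 := pow_le_pow_right₀ hH1 (by norm_num)
        have hLL : 1 + Real.log (H : ℝ) ≤ (1 + Real.log (H : ℝ)) ^ 2 := by nlinarith
        exact mul_le_mul hH3 hLL (by linarith) (by positivity)
      nlinarith
    exact h1.trans hprem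
  obtain ⟨g, hg, hL, hdef⟩ := hmain H hH s hs hprem' U hU hS
  refine ⟨g, hg, hL, fun e he => (hdef e he).trans ?_⟩
  have hLL : (1 + Real.log (H : ℝ)) ^ 2 ≤ (1 + Real.log (H : ℝ)) ^ 4 := by
    have : 1 ≤ (1 + Real.log (H : ℝ)) ^ 2 := one_le_pow₀ hL1
    nlinarith
  have hX : 0 ≤ C * (H : ℝ) ^ 2 * s ^ 2 := by positivity
  nlinarith

end Summit.QuantumFields.YangMills.Theorems.AllWindowsColdBoxBoxHighLine

end
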